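import Summits.BirchSwinnertonDyer.BirchSwinnertonDyer.Theorems.SmallImageMuTransferMuTransferX9StepFourFinal
import Summits.BirchSwinnertonDyer.BirchSwinnertonDyer.Theorems.ByReductionTypeAtTwoOrdKatoHalfAtTwoIsoPortRealPlace
import HarnessLib

/-!
# Route ByReductionTypeAtTwo, crux `OrdKatoHalfAtTwoIso` (stmt-BirchSwinnertonDyer-19573), line
# `steinberg-fibre-at-two` (skeleton v5): helper W4c = interior step M4 of `stub_HK_kolyvaginRankOneTwo` —
# STEP 4 (the Poitou–Tate sum ⟹ the convolution coefficients vanish, given the `q`-term identity) WITH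
# THE REAL-PLACE VANISHING AS A HYPOTHESIS `hinf` instead of `p ≠ 2`, and its `p = 2`, `Δ < 0` instance

HONEST FRAMING (cell bsd-2adic): BSD is not proved by any of this; the crux `OrdKatoHalfAtTwoIso` is NOT
proved here; `stub_HK_kolyvaginRankOneTwo` is not proved; nothing is booked. This file is a KERNEL HELPER
for the line `Cruxes/OrdKatoHalfAtTwoIso/Lines/steinberg_fibre_at_two.lean` (`--supports … --as helper`;
it is not one of the line's registered stubs). TOOL theorems only: no definition, no named fact, no
instance, no `sorry`; nothing is asserted about any curve.

## What is here

The odd core's STEP 4 (`…X9StepFourFinal`, `…X9StepFourReciprocitySets`) uses `p ≠ 2` at exactly ONE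
place: the local term of the Poitou–Tate sum at an INFINITE place `w` vanishes because `H¹(K_w, 𝒯_J)` is
killed by `2` and by the odd `p` (`StepFour.localTerm_inl_eq_zero_of_odd`). This file re-runs the chain
`localTerm_inr_eq_zero_of_unramified_outside_set` → `localTerm_pairingDual_eq_zero_of_unramified_outside_set`
→ `localTerm_twistDualMap_eq_zero_of_unramified_outside_set` → `localTerm_iterate_shiftH1_eq_zero_of_stub_hypotheses`
→ `inv_cupProduct_restrict_iterate_localShift_eq_zero_of_stub_hypotheses` → `convCoeff_eq_zero_of_qTermIdentity`
with the single hypothesis `hp : p ≠ 2` (resp. `hn : Odd n`) REPLACED by the archimedean vanishing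
`hinf : ∀ w, H¹(K_w, 𝒯_J) = 0` (resp. every localisation at `Sum.inl w` vanishes) — each link a verbatim
copy of the tree theorem with that one argument changed (names `…_of_inl`; the bottom link
`StepFour.localTerm_inr_eq_zero_of_unramified_outside_set_of_inl` is the tree's, file `…PortRealPlace`):

* §1 `localTerm_pairingDual_eq_zero_of_unramified_outside_set_of_inl` (equivariant pairing `B : M₁ × M₂ → μₙ`,
  `S` a set of finite places);
* §2 on the Iwasawa twists `𝒯_J = κ.twistModP ρ hM J`, `𝒯'_J = κ.invTwist.twistModP ρ' hM' J`:
  `localTerm_twistDualMap_eq_zero_of_unramified_outside_set_of_inl`,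
  `localTerm_iterate_shiftH1_eq_zero_of_stub_hypotheses_of_inl`,
  `inv_cupProduct_restrict_iterate_localShift_eq_zero_of_stub_hypotheses_of_inl`, and the G3/G4 meeting
  point **`convCoeff_eq_zero_of_qTermIdentity_of_inl`**: STEP 4 + the `q`-term identity `hQ` ⟹
  `C_i(c(res τ_q), Ψc(res Fr_q)) = 0` for every `i + ε < J`;
* §3 the `p = 2` instance on the objects of `stub_HK_kolyvaginRankOneTwo` (`ℚ`, `W.modPTwist 2 κ J`, a Weil
  pairing `eW`), habitat `Δ(E) < 0`: **`convCoeff_eq_zero_of_qTermIdentity_modPTwist_two`**, with `hinf`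
  DISCHARGED by H14 (`galoisCohomology_toLocal_inl_modPTwist_two_eq_zero_of_Δ_neg`: complex conjugation
  lies in `ker κ` and is a transposition on `E[2]` when `Δ < 0`, so `H¹(ℝ, 𝒯_J(E)) = 0`).

How H-K plugs in (nothing of it asserted here): the Poitou–Tate sum `Σ_v inv_v(loc_v κ_q ∪ loc_v Ψ) = 0`
kills every term but the one at the Kolyvagin prime `q` (finite `v ∉ S`: unramified ⊥ unramified;
`v ∈ S`: `loc_v (T^ε Ψ) = 0`; `v ∣ ∞`: `hinf`); the `q`-term identity `hQ` (helper W4b) then turns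
«`q`-term ∈ T^{J−ε}» into the vanishing of the convolution coefficients (`convCoeff_eq_zero_of_family_eq_zero`).

References: MU-TRANSFER-PROOF §2 Lemma 1 (iii), §5 STEP 4, (F7); B. Mazur, K. Rubin, Mem. AMS 799 (2004)
Prop. 1.3.2, §4.4 [MazurRubin2004]; J. S. Milne, *Arithmetic Duality Theorems* (2006), I Thm. 4.10 (b),
Thm. 2.6, Rem. 3.7 [MilneADT2006]; J.-P. Serre, *Galois Cohomology* (1997), I §2.4, II §6.1
[SerreGaloisCohomology1997].
-/

set_option autoImplicit false
-- the summit and its single problem are both named `BirchSwinnertonDyer` (registry layout D-0017)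
set_option linter.dupNamespace false

noncomputable section

open scoped ContRepresentation
open Function NumberField IsDedekindDomain Field Finset
open scoped NumberField
open Literature.NumberTheory.GaloisRepresentations
open Literature.NumberTheory.GaloisRepresentations.DiscreteGaloisModule (mu MuCarrier pairing TateDual
  tateDual pairingDualIntertwining)
open Literature.NumberTheory.GaloisCohomology
open Literature.NumberTheory.EllipticCurves
open Summit.BirchSwinnertonDyer.Rank1Residual.GaloisImage
open _root_.TopRep _root_.ContRepresentation _root_.ContinuousCohomology

universe u

namespace Summit.BirchSwinnertonDyer.BirchSwinnertonDyer.Rank1Residual.StepFour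

variable {K : Type u} [Field K] [NumberField K]

/-! ### §1 Generic: an equivariant pairing `B : M₁ × M₂ → μₙ`, `S` a set, `hinf` instead of `Odd n` -/

section Generic

variable {M : Type u} [AddCommGroup M] [TopologicalSpace M] [DiscreteTopology M] [Finite M] {n : ℕ}
variable {M₂ : Type u} [AddCommGroup M₂] [TopologicalSpace M₂] [DiscreteTopology M₂]
variable {ρ₁ : DiscreteGaloisModule K M} {ρ₂ : DiscreteGaloisModule K M₂}
variable {B : M →+ M₂ →+ MuCarrier K n}
variable (hB : ∀ (σ : absoluteGaloisGroup K) (x : M) (y : M₂), B (ρ₁ σ x) (ρ₂ σ y) = mu K n σ (B x y))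
include hB

-- adapted from `StepFour.localTerm_pairingDual_eq_zero_of_unramified_outside_set`
-- (…X9StepFourReciprocitySets.lean), `hn : Odd n` ↦ `hinf`
/-- **STEP 4 for an equivariant pairing `B : M₁ × M₂ → μₙ`, `S` a set, the archimedean vanishing as a
HYPOTHESIS** (local-term form, `S` discharged by `loc_v y = 0`): if every localisation of a class of
`H¹(K, M₁)` at an infinite place vanishes (`hinf`), `x`, `y` are unramified at every finite `v ∉ S`, `v ≠ q`
where inertia fixes `M₁`, `M₁^D`, and `loc_v y = 0` on `S`, then the local term at `q` of `(x, (B^♭)_* y)`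
vanishes. [cite: MilneADT2006, Ch. I, Thm. 4.10(b)] -/
theorem localTerm_pairingDual_eq_zero_of_unramified_outside_set_of_inl [NeZero n]
    (hinf : ∀ (w : InfinitePlace K) (x : galoisCohomology ρ₁ 1),
      galoisCohomology.localization ρ₁ (Sum.inl w) 1 x = 0)
    {inv : LocalInvariants K n} (hPT : inv.SumLocalTermEqZero) (hM : ∀ m : M, n • m = 0)
    (S : Set (HeightOneSpectrum (𝓞 K))) (q : HeightOneSpectrum (𝓞 K))
    (x : galoisCohomology ρ₁ 1) (y : galoisCohomology ρ₂ 1)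
    (hI : ∀ v ∉ S, v ≠ q → ∀ t ∈ absInertia (v.adicCompletion K), ∀ m : M,
      GaloisRep.toLocal v ρ₁ t m = m)
    (hID : ∀ v ∉ S, v ≠ q → ∀ t ∈ absInertia (v.adicCompletion K), ∀ f : TateDual K M n,
      GaloisRep.toLocal v (ρ₁.tateDual n) t f = f)
    (hx : ∀ v ∉ S, v ≠ q → galoisCohomology.localization ρ₁ (Sum.inr v) 1 x ∈
      DiscreteGaloisModule.unramifiedSubgroup (GaloisRep.toLocal v ρ₁) 1)
    (hy : ∀ v ∉ S, v ≠ q → galoisCohomology.localization ρ₂ (Sum.inr v) 1 y ∈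
      DiscreteGaloisModule.unramifiedSubgroup (GaloisRep.toLocal v ρ₂) 1)
    (hS : ∀ v ∈ S, galoisCohomology.localization ρ₂ (Sum.inr v) 1 y = 0) :
    inv.localTerm ρ₁ (Sum.inr q) x (galoisCohomology.map (pairingDualIntertwining hB) 1 y) = 0 := by
  refine localTerm_inr_eq_zero_of_unramified_outside_set_of_inl hPT ρ₁ hM hinf S q x _ hI hID hx
    (fun v hvS hvq => localization_map_mem_unramifiedSubgroup _ v (hy v hvS hvq)) fun v hvS => ?_
  refine localTerm_eq_zero_of_localization_right_eq_zero inv ρ₁ (Sum.inr v) x ?_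
  rw [localization_map_eq, hS v hvS]
  exact map_zero _

end Generic

/-! ### §2 The Iwasawa twists: `hinf : H¹(K_w, 𝒯_J) = 0` at every infinite `w` instead of `p ≠ 2` -/

section Twist

variable {p : ℕ} [Fact p.Prime] (κ : ZpExtension K p)
variable {M M' : Type u} [AddCommGroup M] [TopologicalSpace M] [DiscreteTopology M] [Finite M]
  [AddCommGroup M'] [TopologicalSpace M'] [DiscreteTopology M']
variable (ρ : DiscreteGaloisModule K M) (ρ' : DiscreteGaloisModule K M')
  (hM : ∀ x : M, p • x = 0) (hM' : ∀ x : M', p • x = 0) (J : ℕ)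
variable {e : M →+ M' →+ MuCarrier K p}
  (he : ∀ (g : absoluteGaloisGroup K) (m : M) (m' : M'), e (ρ g m) (ρ' g m') = mu K p g (e m m'))
include he

-- adapted from `StepFour.localTerm_twistDualMap_eq_zero_of_unramified_outside_set`
-- (…X9StepFourReciprocitySets.lean), `hp : p ≠ 2` ↦ `hinf`
/-- **STEP 4 on the Iwasawa twists, `S` a set, the archimedean vanishing as a HYPOTHESIS.** `inv` with the
Poitou–Tate vanishing; `H¹(K_w, 𝒯_J(ρ, κ)) = 0` at every infinite `w` (`hinf`); every finite `v ∉ S`,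
`v ≠ q` has `v ∤ p` and `ρ` unramified; `x ∈ H¹(K, 𝒯_J(ρ, κ))`, `y ∈ H¹(K, 𝒯_J(ρ′, κ⁻¹))` unramified off
`S ∪ {q}`; `loc_v y = 0` on `S` ⟹ the local term at `q` of `(x, (twistDualMap)_* y)` vanishes.
[cite: MilneADT2006, Ch. I, Thm. 4.10(b)] -/
theorem localTerm_twistDualMap_eq_zero_of_unramified_outside_set_of_inl
    (hinf : ∀ (w : InfinitePlace K) (x : galoisCohomology ((κ.twistModP ρ hM J).toLocal (Sum.inl w)) 1),
      x = 0)
    {inv : LocalInvariants K p} (hPT : inv.SumLocalTermEqZero)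
    (S : Set (HeightOneSpectrum (𝓞 K))) (q : HeightOneSpectrum (𝓞 K))
    (hSp : ∀ v ∉ S, v ≠ q → ((p : ℕ) : 𝓞 K) ∉ v.asIdeal)
    (hur : ∀ v ∉ S, v ≠ q → GaloisRep.IsUnramifiedAt v ρ)
    (x : galoisCohomology (κ.twistModP ρ hM J) 1)
    (y : galoisCohomology (κ.invTwist.twistModP ρ' hM' J) 1)
    (hx : ∀ v ∉ S, v ≠ q → galoisCohomology.localization (κ.twistModP ρ hM J) (Sum.inr v) 1 x ∈
      DiscreteGaloisModule.unramifiedSubgroup (GaloisRep.toLocal v (κ.twistModP ρ hM J)) 1)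
    (hy : ∀ v ∉ S, v ≠ q →
      galoisCohomology.localization (κ.invTwist.twistModP ρ' hM' J) (Sum.inr v) 1 y ∈
        DiscreteGaloisModule.unramifiedSubgroup (GaloisRep.toLocal v (κ.invTwist.twistModP ρ' hM' J)) 1)
    (hS : ∀ v ∈ S, galoisCohomology.localization (κ.invTwist.twistModP ρ' hM' J) (Sum.inr v) 1 y = 0) :
    inv.localTerm (κ.twistModP ρ hM J) (Sum.inr q) x
      (galoisCohomology.map (κ.twistDualMap ρ ρ' p hM hM' J he) 1 y) = 0 := by
  haveI : NeZero p := ⟨(Fact.out : p.Prime).ne_zero⟩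
  exact localTerm_pairingDual_eq_zero_of_unramified_outside_set_of_inl
    (κ.gorensteinPairing_twistModP_smul ρ ρ' (mu K p) hM hM' J he) (fun w x' => hinf w _)
    hPT (nsmul_twist_eq_zero hM J) S q x y
    (fun v hvS hvq _ ht z =>
      toLocal_twistModP_apply_of_mem_absInertia κ ρ hM J v (hur v hvS hvq) (hSp v hvS hvq) ht z)
    (fun v hvS hvq _ ht f =>
      toLocal_tateDual_twistModP_apply_of_mem_absInertia κ ρ hM J v (hur v hvS hvq) (hSp v hvS hvq) ht f)
    hx hy hS

-- adapted from `StepFour.localTerm_iterate_shiftH1_eq_zero_of_stub_hypotheses`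
-- (…X9StepFourReciprocitySets.lean), `hp : p ≠ 2` ↦ `hinf`
/-- **STEP 4 on the twists in the hypothesis shape of the stub, the archimedean vanishing as a HYPOTHESIS**
(`S : Set`, the Selmer-side class `Ψ` unramified off `S`, `loc_v (T^[ε] Ψ) = 0` for `v ∈ S` as a GLOBAL
iterate, `q ∉ S`; `H¹(K_w, 𝒯_J(ρ, κ)) = 0` at every infinite `w`) — every finite `v ∉ S` has `v ∤ p` and `ρ`
unramified, `x ∈ H¹(K, 𝒯_J(ρ, κ))` unramified off `S ∪ {q}` (the Kolyvagin class `κ_q`): for EVERY `k` the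
local term at `q` of `(T^k x, (twistDualMap)_* (T^ε Ψ))` vanishes. [cite: MilneADT2006, Ch. I, Thm. 4.10(b)] -/
theorem localTerm_iterate_shiftH1_eq_zero_of_stub_hypotheses_of_inl
    (hinf : ∀ (w : InfinitePlace K) (x : galoisCohomology ((κ.twistModP ρ hM J).toLocal (Sum.inl w)) 1),
      x = 0)
    {inv : LocalInvariants K p} (hPT : inv.SumLocalTermEqZero)
    (S : Set (HeightOneSpectrum (𝓞 K))) (q : HeightOneSpectrum (𝓞 K)) (hq : q ∉ S)
    (hSp : ∀ v ∉ S, ((p : ℕ) : 𝓞 K) ∉ v.asIdeal)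
    (hur : ∀ v ∉ S, GaloisRep.IsUnramifiedAt v ρ)
    (x : galoisCohomology (κ.twistModP ρ hM J) 1)
    (hx : ∀ v ∉ S, v ≠ q → galoisCohomology.localization (κ.twistModP ρ hM J) (Sum.inr v) 1 x ∈
      DiscreteGaloisModule.unramifiedSubgroup (GaloisRep.toLocal v (κ.twistModP ρ hM J)) 1)
    (Ψ : galoisCohomology (κ.invTwist.twistModP ρ' hM' J) 1)
    (hΨ : ∀ v ∉ S, galoisCohomology.localization (κ.invTwist.twistModP ρ' hM' J) (Sum.inr v) 1 Ψ ∈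
      DiscreteGaloisModule.unramifiedSubgroup (GaloisRep.toLocal v (κ.invTwist.twistModP ρ' hM' J)) 1)
    (ε : ℕ)
    (hΨS : ∀ v ∈ S, galoisCohomology.localization (κ.invTwist.twistModP ρ' hM' J) (Sum.inr v) 1
      ((κ.invTwist.shiftH1 ρ' hM' J)^[ε] Ψ) = 0)
    (k : ℕ) :
    inv.localTerm (κ.twistModP ρ hM J) (Sum.inr q) ((κ.shiftH1 ρ hM J)^[k] x)
      (galoisCohomology.map (κ.twistDualMap ρ ρ' p hM hM' J he) 1
        ((κ.invTwist.shiftH1 ρ' hM' J)^[ε] Ψ)) = 0 := by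
  have _ := hq
  exact localTerm_twistDualMap_eq_zero_of_unramified_outside_set_of_inl κ ρ ρ' hM hM' J he hinf hPT S q
    (fun v hvS _ => hSp v hvS) (fun v hvS _ => hur v hvS) _ _
    (fun v hvS hvq => iterate_shiftH1_localization_mem_unramifiedSubgroup κ ρ hM J v (hx v hvS hvq) k)
    (fun v hvS _ => iterate_shiftH1_localization_mem_unramifiedSubgroup κ.invTwist ρ' hM' J v (hΨ v hvS) ε)
    hΨS

variable [LocallyCompactSpace (absoluteGaloisGroup K)]

-- adapted from `StepFour.inv_cupProduct_restrict_iterate_localShift_eq_zero_of_stub_hypotheses`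
-- (…X9StepFourReciprocitySets.lean), `hp : p ≠ 2` ↦ `hinf`
/-- **STEP 4 in the stub's hypothesis shape, read on local classes at `q`, the archimedean vanishing as a
HYPOTHESIS**: `inv_q(T_q^k (loc_q x) ∪ loc_q (T^ε Ψ)) = 0` for every `k`, the cup product being that of
k6-ty's `twistContPairing` restricted to `Γ_{K_q}`, `T_q = H¹(twistModPShift|_{Γ_{K_q}})`.
[cite: MilneADT2006, Ch. I, Thm. 4.10(b)] -/
theorem inv_cupProduct_restrict_iterate_localShift_eq_zero_of_stub_hypotheses_of_inl
    (hinf : ∀ (w : InfinitePlace K) (x : galoisCohomology ((κ.twistModP ρ hM J).toLocal (Sum.inl w)) 1),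
      x = 0)
    {inv : LocalInvariants K p} (hPT : inv.SumLocalTermEqZero)
    (S : Set (HeightOneSpectrum (𝓞 K))) (q : HeightOneSpectrum (𝓞 K)) (hq : q ∉ S)
    [LocallyCompactSpace (absoluteGaloisGroup (Place.Completion (Sum.inr q : Place K)))]
    (hSp : ∀ v ∉ S, ((p : ℕ) : 𝓞 K) ∉ v.asIdeal)
    (hur : ∀ v ∉ S, GaloisRep.IsUnramifiedAt v ρ)
    (x : galoisCohomology (κ.twistModP ρ hM J) 1)
    (hx : ∀ v ∉ S, v ≠ q → galoisCohomology.localization (κ.twistModP ρ hM J) (Sum.inr v) 1 x ∈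
      DiscreteGaloisModule.unramifiedSubgroup (GaloisRep.toLocal v (κ.twistModP ρ hM J)) 1)
    (Ψ : galoisCohomology (κ.invTwist.twistModP ρ' hM' J) 1)
    (hΨ : ∀ v ∉ S, galoisCohomology.localization (κ.invTwist.twistModP ρ' hM' J) (Sum.inr v) 1 Ψ ∈
      DiscreteGaloisModule.unramifiedSubgroup (GaloisRep.toLocal v (κ.invTwist.twistModP ρ' hM' J)) 1)
    (ε : ℕ)
    (hΨS : ∀ v ∈ S, galoisCohomology.localization (κ.invTwist.twistModP ρ' hM' J) (Sum.inr v) 1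
      ((κ.invTwist.shiftH1 ρ' hM' J)^[ε] Ψ) = 0)
    (k : ℕ) :
    inv (Sum.inr q)
      (((κ.twistContPairing ρ ρ' (mu K p) hM hM' J he).restrict
          (absGaloisRestrict K (Place.Completion (Sum.inr q : Place K)))).cupProduct
        ((galoisCohomology.map ((κ.twistModPShift ρ hM J).restrictField (q.adicCompletion K)) 1)^[k]
          (galoisCohomology.localization (κ.twistModP ρ hM J) (Sum.inr q) 1 x))
        (galoisCohomology.localization (κ.invTwist.twistModP ρ' hM' J) (Sum.inr q) 1
          ((κ.invTwist.shiftH1 ρ' hM' J)^[ε] Ψ))) = 0 := by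
  rw [← localization_iterate_shiftH1, ← localization_cupProduct_twistContPairing]
  have h := localTerm_iterate_shiftH1_eq_zero_of_stub_hypotheses_of_inl κ ρ ρ' hM hM' J he hinf hPT S q
    hq hSp hur x hx Ψ hΨ ε hΨS k
  rw [show κ.twistDualMap ρ ρ' p hM hM' J he = pairingDualIntertwining
      (κ.gorensteinPairing_twistModP_smul ρ ρ' (mu K p) hM hM' J he) from rfl,
    DiscreteGaloisModule.localTerm_pairingDual] at h
  exact h

-- adapted from `StepFour.convCoeff_eq_zero_of_qTermIdentity` (…X9StepFourFinal.lean), `hp : p ≠ 2` ↦ `hinf`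
/-- **The G3/G4 meeting point (generic twists), the archimedean vanishing as a HYPOTHESIS: STEP 4 + the
`q`-term identity ⟹ `C_i(c(res τ_q), Ψc(res Fr_q)) = 0` for every `i + ε < J`.** Data as in the tree's
`convCoeff_eq_zero_of_qTermIdentity` (a number field `K`, a prime `p`, `κ : ZpExtension K p`, twists
`𝒯_J = κ.twistModP ρ hM J`, `𝒯'_J = κ.invTwist.twistModP ρ' hM' J`, an equivariant `e : M × M′ → μ_p`,
`inv` with the Poitou–Tate vanishing, `S ⊇ {v ∣ p} ∪ {ramified}`, `q ∉ S`, a global cocycle `c` of `𝒯_J`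
unramified off `S ∪ {q}`, a global cocycle `Ψc` of `𝒯'_J` with the stub's two clauses, `τ_q, Fr_q ∈ Γ_{K_q}`,
trivialisations `ι`, `ι′` (`ι′` injective), a sequence `u` with `u 0` a unit, and `hQ` = Lemma 1 (iii)
instantiated at the local classes), with `hp : p ≠ 2` REPLACED by `hinf : H¹(K_w, 𝒯_J) = 0` at every
infinite `w` — the only use of `p` odd in STEP 4. [cite: MazurRubin2004, Prop. 1.3.2 and §4.4]
[cite: MilneADT2006, Ch. I, Thm. 4.10(b)] -/
theorem convCoeff_eq_zero_of_qTermIdentity_of_inl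
    (hinf : ∀ (w : NumberField.InfinitePlace K)
      (x : galoisCohomology ((κ.twistModP ρ hM J).toLocal (Sum.inl w)) 1), x = 0)
    {inv : LocalInvariants K p}
    (hPT : inv.SumLocalTermEqZero) (S : Set (HeightOneSpectrum (𝓞 K))) (q : HeightOneSpectrum (𝓞 K))
    (hq : q ∉ S) [LocallyCompactSpace (absoluteGaloisGroup (Place.Completion (Sum.inr q : Place K)))]
    (hSp : ∀ v ∉ S, ((p : ℕ) : 𝓞 K) ∉ v.asIdeal) (hur : ∀ v ∉ S, GaloisRep.IsUnramifiedAt v ρ)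
    (c : contOneCocycles (κ.twistModP ρ hM J).toTopRep)
    (hx : ∀ v ∉ S, v ≠ q → galoisCohomology.localization (κ.twistModP ρ hM J) (Sum.inr v) 1
        (oneCocycleClass (κ.twistModP ρ hM J).toTopRep c) ∈
      DiscreteGaloisModule.unramifiedSubgroup (GaloisRep.toLocal v (κ.twistModP ρ hM J)) 1)
    (Ψc : contOneCocycles (κ.invTwist.twistModP ρ' hM' J).toTopRep)
    (hΨ : ∀ v ∉ S, galoisCohomology.localization (κ.invTwist.twistModP ρ' hM' J) (Sum.inr v) 1
        (oneCocycleClass (κ.invTwist.twistModP ρ' hM' J).toTopRep Ψc) ∈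
      DiscreteGaloisModule.unramifiedSubgroup (GaloisRep.toLocal v (κ.invTwist.twistModP ρ' hM' J)) 1)
    (ε : ℕ)
    (hΨS : ∀ v ∈ S, galoisCohomology.localization (κ.invTwist.twistModP ρ' hM' J) (Sum.inr v) 1
      ((κ.invTwist.shiftH1 ρ' hM' J)^[ε] (oneCocycleClass (κ.invTwist.twistModP ρ' hM' J).toTopRep Ψc)) = 0)
    (τq Frq : absoluteGaloisGroup (q.adicCompletion K))
    {R : Type*} [CommRing R] (ι : ZMod p →+ R) (ι' : MuCarrier K p →+ R) (hι' : Function.Injective ι')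
    (u : ℕ → R) (hu : IsUnit (u 0))
    (hQ : ∀ k < J, ι (inv (Sum.inr q)
        (((κ.twistContPairing ρ ρ' (mu K p) hM hM' J he).restrict
            (absGaloisRestrict K (Place.Completion (Sum.inr q : Place K)))).cupProduct
          ((galoisCohomology.map ((κ.twistModPShift ρ hM J).restrictField (q.adicCompletion K)) 1)^[J - 1 - k]
            (galoisCohomology.localization (κ.twistModP ρ hM J) (Sum.inr q) 1
              (oneCocycleClass (κ.twistModP ρ hM J).toTopRep c)))
          (galoisCohomology.localization (κ.invTwist.twistModP ρ' hM' J) (Sum.inr q) 1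
            ((κ.invTwist.shiftH1 ρ' hM' J)^[ε]
              (oneCocycleClass (κ.invTwist.twistModP ρ' hM' J).toTopRep Ψc))))) =
      ∑ j ∈ range (k + 1), u j * ι' (convCoeff e J (k - j)
        (c.1 (absGaloisRestrict K (q.adicCompletion K) τq))
        ((shiftEnd M' J ^ ε) (Ψc.1 (absGaloisRestrict K (q.adicCompletion K) Frq))))) :
    ∀ i, i + ε < J → convCoeff e J i (c.1 (absGaloisRestrict K (q.adicCompletion K) τq))
      (Ψc.1 (absGaloisRestrict K (q.adicCompletion K) Frq)) = 0 := by
  refine convCoeff_eq_zero_of_family_eq_zero e ι' hι' hu ε _ _ fun k hk => ?_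
  rw [← hQ k hk, inv_cupProduct_restrict_iterate_localShift_eq_zero_of_stub_hypotheses_of_inl κ ρ ρ' hM hM'
    J he hinf hPT S q hq hSp hur _ hx _ hΨ ε hΨS (J - 1 - k), map_zero]

end Twist

/-! ### §3 The `p = 2` instance on the objects of `stub_HK_kolyvaginRankOneTwo` (`ℚ`, `W.modPTwist 2 κ J`,
a Weil pairing `eW`), habitat `Δ(E) < 0`: `hinf` discharged by H14 -/

section CurveTwo

variable (W : WeierstrassCurve ℚ) (κ : ZpExtension ℚ 2)
variable (eW : WeierstrassCurve.geomTorsion W ((2 : ℕ) : ℤ) → WeierstrassCurve.geomTorsion W ((2 : ℕ) : ℤ) →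
    AlgebraicClosure ℚ)
  (hμ : ∀ S T, eW S T ^ 2 = 1) (hadd₁ : ∀ S₁ S₂ T, eW (S₁ + S₂) T = eW S₁ T * eW S₂ T)
  (hadd₂ : ∀ S T₁ T₂, eW S (T₁ + T₂) = eW S T₁ * eW S T₂)
  (hgal : ∀ (σ : absoluteGaloisGroup ℚ) (S T : WeierstrassCurve.geomTorsion W ((2 : ℕ) : ℤ)),
    σ • eW S T = eW (σ • S) (σ • T))

-- adapted from `StepFour.convCoeff_eq_zero_of_qTermIdentity_modPTwist` (…X9StepFourFinal.lean) at `p = 2`,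
-- `hp` removed, `hΔ : W.Δ < 0` added, `hinf` discharged by `galoisCohomology_toLocal_inl_modPTwist_two_eq_zero_of_Δ_neg`
/-- **The G3/G4 meeting point of `stub_HK_kolyvaginRankOneTwo` on its own objects, `p = 2`, `Δ(E) < 0`.**
`c` a cocycle of the Kolyvagin class in `H¹(ℚ, W.modPTwist 2 κ J)` (unramified off `S ∪ {q}`); `Ψc` the
stub's cocycle with its two clauses; `hQ` = Lemma 1 (iii) instantiated (local-class currency, Weil pairing
through `weilPairingHom`, `he := weilPairingHom_torsionGaloisModule_smul … hgal`) ⟹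
`convCoeff (weilPairingHom …) J i (c(res τ_q)) (Ψc(res Fr_q)) = 0` for all `i + ε < J`. The real place
contributes nothing to the Poitou–Tate sum by H14 (`galoisCohomology_toLocal_inl_modPTwist_two_eq_zero_of_Δ_neg`:
complex conjugation lies in `ker κ` and is a transposition on `E[2]` when `Δ < 0`), NOT by oddness of the
level. (`E[2]` finite is an instance hypothesis, as in the odd original; discharge it with the tree's
`finite_geomTorsion_of_neZero W 2`.) [cite: MazurRubin2004, Prop. 1.3.2 and §4.4]
[cite: MilneADT2006, Ch. I, Thm. 4.10(b)] -/
theorem convCoeff_eq_zero_of_qTermIdentity_modPTwist_two [W.IsElliptic]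
    [Finite (WeierstrassCurve.geomTorsion W ((2 : ℕ) : ℤ))] [LocallyCompactSpace (absoluteGaloisGroup ℚ)]
    (hΔ : W.Δ < 0) {inv : LocalInvariants ℚ 2} (hPT : inv.SumLocalTermEqZero) (J : ℕ)
    (S : Set (HeightOneSpectrum (𝓞 ℚ))) (q : HeightOneSpectrum (𝓞 ℚ)) (hq : q ∉ S)
    [LocallyCompactSpace (absoluteGaloisGroup (Place.Completion (Sum.inr q : Place ℚ)))]
    (hSp : ∀ v ∉ S, ((2 : ℕ) : 𝓞 ℚ) ∉ v.asIdeal)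
    (hur : ∀ v ∉ S, GaloisRep.IsUnramifiedAt v (W.torsionGaloisModule ((2 : ℕ) : ℤ)))
    (c : contOneCocycles (W.modPTwist 2 κ J).toTopRep)
    (hx : ∀ v ∉ S, v ≠ q → galoisCohomology.localization (W.modPTwist 2 κ J) (Sum.inr v) 1
        (oneCocycleClass (W.modPTwist 2 κ J).toTopRep c) ∈
      DiscreteGaloisModule.unramifiedSubgroup (GaloisRep.toLocal v (W.modPTwist 2 κ J)) 1)
    (Ψc : contOneCocycles (W.modPTwist 2 κ.invTwist J).toTopRep)
    (hΨ : ∀ v : HeightOneSpectrum (𝓞 ℚ), v ∉ S →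
      galoisCohomology.localization (W.modPTwist 2 κ.invTwist J) (Sum.inr v) 1
          (oneCocycleClass (W.modPTwist 2 κ.invTwist J).toTopRep Ψc) ∈
        DiscreteGaloisModule.unramifiedSubgroup (GaloisRep.toLocal v (W.modPTwist 2 κ.invTwist J)) 1)
    (ε : ℕ)
    (hΨS : ∀ v : HeightOneSpectrum (𝓞 ℚ), v ∈ S →
      galoisCohomology.localization (W.modPTwist 2 κ.invTwist J) (Sum.inr v) 1
        ((κ.invTwist.shiftH1 (W.torsionGaloisModule ((2 : ℕ) : ℤ))
          (fun P : WeierstrassCurve.geomTorsion W ((2 : ℕ) : ℤ) => AddSubgroup.torsionBy.nsmul P) J)^[ε]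
          (oneCocycleClass (W.modPTwist 2 κ.invTwist J).toTopRep Ψc)) = 0)
    (τq Frq : absoluteGaloisGroup (q.adicCompletion ℚ))
    {R : Type*} [CommRing R] (ι : ZMod 2 →+ R) (ι' : MuCarrier ℚ 2 →+ R) (hι' : Function.Injective ι')
    (u : ℕ → R) (hu : IsUnit (u 0))
    (hQ : ∀ k < J, ι (inv (Sum.inr q)
        (((κ.twistContPairing (W.torsionGaloisModule ((2 : ℕ) : ℤ)) (W.torsionGaloisModule ((2 : ℕ) : ℤ))
              (mu ℚ 2) (fun P => AddSubgroup.torsionBy.nsmul P) (fun P => AddSubgroup.torsionBy.nsmul P) J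
              (weilPairingHom_torsionGaloisModule_smul W 2 eW hμ hadd₁ hadd₂ hgal)).restrict
            (absGaloisRestrict ℚ (Place.Completion (Sum.inr q : Place ℚ)))).cupProduct
          ((galoisCohomology.map ((κ.twistModPShift (W.torsionGaloisModule ((2 : ℕ) : ℤ))
              (fun P => AddSubgroup.torsionBy.nsmul P) J).restrictField (q.adicCompletion ℚ)) 1)^[J - 1 - k]
            (galoisCohomology.localization (W.modPTwist 2 κ J) (Sum.inr q) 1
              (oneCocycleClass (W.modPTwist 2 κ J).toTopRep c)))
          (galoisCohomology.localization (W.modPTwist 2 κ.invTwist J) (Sum.inr q) 1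
            ((κ.invTwist.shiftH1 (W.torsionGaloisModule ((2 : ℕ) : ℤ))
              (fun P : WeierstrassCurve.geomTorsion W ((2 : ℕ) : ℤ) => AddSubgroup.torsionBy.nsmul P) J)^[ε]
              (oneCocycleClass (W.modPTwist 2 κ.invTwist J).toTopRep Ψc))))) =
      ∑ j ∈ range (k + 1), u j * ι' (convCoeff (weilPairingHom W 2 eW hμ hadd₁ hadd₂) J (k - j)
        (c.1 (absGaloisRestrict ℚ (q.adicCompletion ℚ) τq))
        ((shiftEnd (WeierstrassCurve.geomTorsion W ((2 : ℕ) : ℤ)) J ^ ε)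
          (Ψc.1 (absGaloisRestrict ℚ (q.adicCompletion ℚ) Frq))))) :
    ∀ i, i + ε < J → convCoeff (weilPairingHom W 2 eW hμ hadd₁ hadd₂) J i
      (c.1 (absGaloisRestrict ℚ (q.adicCompletion ℚ) τq)) (Ψc.1 (absGaloisRestrict ℚ (q.adicCompletion ℚ) Frq)) =
      0 := by
  have hinf : ∀ (w : NumberField.InfinitePlace ℚ)
      (x : galoisCohomology ((W.modPTwist 2 κ J).toLocal (Sum.inl w)) 1), x = 0 :=
    fun w x => galoisCohomology_toLocal_inl_modPTwist_two_eq_zero_of_Δ_neg W κ hΔ J w x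
  unfold WeierstrassCurve.modPTwist at c hx Ψc hΨ hΨS hQ hinf ⊢
  exact convCoeff_eq_zero_of_qTermIdentity_of_inl κ (W.torsionGaloisModule ((2 : ℕ) : ℤ))
    (W.torsionGaloisModule ((2 : ℕ) : ℤ)) (fun P => AddSubgroup.torsionBy.nsmul P)
    (fun P => AddSubgroup.torsionBy.nsmul P) J
    (weilPairingHom_torsionGaloisModule_smul W 2 eW hμ hadd₁ hadd₂ hgal) hinf hPT S q hq hSp hur c hx Ψc hΨ ε
    hΨS τq Frq ι ι' hι' u hu hQ

end CurveTwo

end Summit.BirchSwinnertonDyer.BirchSwinnertonDyer.Rank1Residual.StepFour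

end
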